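import Mathlib
import Summits.KontsevichZagierPeriods.Zeta5Search.TopFamilyFPCellsK
import Summits.KontsevichZagierPeriods.Zeta5Search.DenomLaw.OriginCoverKit
import Summits.KontsevichZagierPeriods.Zeta5Search.DenomLaw.TopFamilyFPDeep
import HarnessLib

/-!
# ζ(5) search — PATH ACCOUNTING on the TOP family's last open cell, the `t = 8, 9` SLIVER (ORIGIN type-space law, `M = 8`), hence on the WHOLE first period of `bTop t n` for EVERY `t ≥ 4`

Cell `pub-zeta5` (HONEST FRAMING: systematic search; no irrationality claim unless certified), TRACK «DENOM-LAW» D1 prover seat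
(denom-prover-d1 g17, `HOME/denom-law/prover-d1/ATTEMPT-17.md`).  Completion of gen 16's `DenomLaw/TopFamilyFPPath` / `DenomLaw/TopFamilyFPDeep`
(the node `DenomLaw.PathAccountingFirstPeriod` — Brown–Zudilin (28)+(30) transported by `G ≅ S₇`, Casoratian form — on the TOP linear family
`bTop t n = bLin (t n + 2n) (t n) n = n·(3t+16; t+8, …, t+2)`, every `t ≥ 4` EXCEPT `t = 8, 9`).  The one cell left open there is the SLIVER
`(t+1)n < p ≤ (2t+13)n/3` (inside the first period `(t+11)n < 2p`), non-empty only for `t = 8, 9`: `⌊d/p⌋ = 3`, `N_p = 20`, `C⋆ ≤ 11`, so the node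
asks `v_p(Cas_j) ≥ −11 = casLB + 2`, one more than THEOREM L5's `−12`.
RESOLUTION (§1–§2): on the sliver the classes of `bTop 8 n` / `bTop 9 n` form an ORIGIN WINDOW at `M = 8` with EXACTLY the tree's universal `M = 8`
origin inventory — deep classes (exponent `−8`) of the types `[1,−6,−4,1]`, `[1,−5,−5,1]`, `[1,−4,−6,1]` (`Ray4Windows.D8`: one palindrome + one conjugate
pair, the type-space ORIGIN configuration), sub-deep classes in `Ray4Windows.S8`, and for `t = 9`, `n` odd the odd-centre class `[1,−5,−5,1]`
(`T1Rays.Pc8`) — by the machine-generated covers `TopFamFP.cover_s8_ev / cover_s9_ev / cover_s9_od` (`TopFamilyFPCellsK`) and the cover kit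
`DenomLaw.originClasses_of_cover` (`decide` after fixing the parity flag); the line data `(u8, c8) = ((33, −49), −174)` are the tree's
(`T1Rays.lineData8c`), the degree condition `6p ≤ 2d + 1` is `3p ≤ (2t+13)n = d`; so the ORIGIN law (`ResidueLaw.typeSpaceLawOrigin_holds` via
`DenomLaw.origin_O8`) gives `v_p(Cas_j(bTop t n)) ≥ 5 − 2M = −11` for every direction `j` (`cas_ge_s8`, `cas_ge_s9`) — a NEW FRAME on the family
(the deep cells of gen 16 are the zero-type frame `(10, [1,−6,−6,1])`; the sliver is the origin frame `(8, D8)`).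
§3: `pathAccounting_tf_sliver`, the whole first period for `t = 8, 9` and every `j` (`pathAccounting_tf_firstPeriod_89`), the node verbatim
`pathAccountingFirstPeriod_on_tf89`, and **`pathAccountingFirstPeriod_on_bTop_all` — the node `PathAccountingFirstPeriod` with `b := bTop t n`, binders
VERBATIM, for EVERY `t ≥ 4` and EVERY `n ≥ 1`, no exception** (with gen 16's `pathAccountingFirstPeriod_on_tf` / `_on_tf_ge10`).  So Brown–Zudilin's
prime-by-prime accounting is a theorem, for all `n`, on the whole first period of EVERY direction `(7,13,9,12,11,15,17,12) + (t−6)·(1,…,1)`, `t ≥ 4`.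
MODEL/structure-side valuation bookkeeping of the cell's own rationals; nothing about ζ(5); no γ; records in print UNMOVED.
-/

open Finset

namespace Summit.KontsevichZagierPeriods.Zeta5Search.TopFamFP

open Summit.KontsevichZagierPeriods.Zeta5Search.ClusterValuation
open Summit.KontsevichZagierPeriods.Zeta5Search.CasoratianValuation (InPolytope shift casoratian pairFloors refund)
open Summit.KontsevichZagierPeriods.Zeta5Search.WedgeDictionary (dOf)
open Summit.KontsevichZagierPeriods.Zeta5Search.ClassTypeCover
open Summit.KontsevichZagierPeriods.Zeta5Search.CellKit
open Summit.KontsevichZagierPeriods.Zeta5Search.TopFamCR (tf_zero dOf_tf inPolytope_tf)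
open Summit.KontsevichZagierPeriods.Zeta5Search.StaircaseCells (bTop)
open Summit.KontsevichZagierPeriods.Zeta5Search.OriginWindows (OriginWindowClasses)
open Summit.KontsevichZagierPeriods.Zeta5Search.DenomLaw (cStar FirstPeriod Sorted7 originClasses_of_cover origin_O8)
open Summit.KontsevichZagierPeriods.Zeta5Search.DenomLaw.FirstPeriodKit (cStar_le_eleven)
open Summit.KontsevichZagierPeriods.Zeta5Search.StairTS3 (refund_le_pathHead)

/-! ## §1 The sliver is an ORIGIN window at `M = 8` with the universal inventory `(D8, S8, Pc8)` -/

/-- **Class structure on the `t = 8` sliver** (`9n < p`, `3p ≤ 29n`, `19n < 2p`; `b₀ = 40n` even), all `n ≥ 1`, all odd `p`: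
`OriginWindowClasses (bTop 8 n) p 8 D8 S8 Pc8`. -/
theorem originClasses_s8 {n p : ℕ} [Fact p.Prime] (hn : 1 ≤ n) (hA : 8 * n + n < p) (hB : 3 * p ≤ 2 * (8 * n) + 13 * n)
    (hF : 8 * n + 11 * n < 2 * p) (hp2 : p % 2 = 1) :
    OriginWindowClasses (bLin (8 * n + 2 * n) (8 * n) n) p 8 Ray4Windows.D8 Ray4Windows.S8 T1Rays.Pc8 :=
  originClasses_of_cover (cover_s8_ev hn hA hB hF hp2 (by omega)) (by rw [oddFlag_even (t := 8) (n := n) (by omega)]; decide)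

/-- **Class structure on the `t = 9` sliver** (`10n < p`, `3p ≤ 31n`; `b₀ = 43n`), `n` even. -/
theorem originClasses_s9_ev {n p : ℕ} [Fact p.Prime] (hn : 1 ≤ n) (hA : 9 * n + n < p) (hB : 3 * p ≤ 2 * (9 * n) + 13 * n)
    (hp2 : p % 2 = 1) (hr : n % 2 = 0) :
    OriginWindowClasses (bLin (9 * n + 2 * n) (9 * n) n) p 8 Ray4Windows.D8 Ray4Windows.S8 T1Rays.Pc8 :=
  originClasses_of_cover (cover_s9_ev hn hA hB (by omega) hp2 (by omega)) (by rw [oddFlag_even (t := 9) (n := n) (by omega)]; decide)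

/-- **Class structure on the `t = 9` sliver**, `n` odd (the odd-centre sub-deep class `[1,−5,−5,1] ∈ Pc8` occurs). -/
theorem originClasses_s9_od {n p : ℕ} [Fact p.Prime] (hn : 1 ≤ n) (hA : 9 * n + n < p) (hB : 3 * p ≤ 2 * (9 * n) + 13 * n)
    (hp2 : p % 2 = 1) (hr : n % 2 = 1) :
    OriginWindowClasses (bLin (9 * n + 2 * n) (9 * n) n) p 8 Ray4Windows.D8 Ray4Windows.S8 T1Rays.Pc8 :=
  originClasses_of_cover (cover_s9_od hn hA hB (by omega) hp2 (by omega) hr) (by rw [oddFlag_odd (t := 9) (n := n) (by omega)]; decide)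

/-! ## §2 The sliver bound `−11`, any direction `j` -/

/-- **The `t = 8` sliver** `9n < p`, `3p ≤ 29n`, `19n < 2p`, any `j`, all `n ≥ 1`: `v_p(Cas_j(bTop 8 n)) ≥ −11 = 5 − 2M` by the ORIGIN type-space law
at `M = 8` (`DenomLaw.origin_O8`; degree condition `6p ≤ 2d + 1` from `3p ≤ d = 29n`). -/
theorem cas_ge_s8 {n j p : ℕ} (hn : 1 ≤ n) (hj1 : 1 ≤ j) (hj7 : j ≤ 7) (hprime : p.Prime)
    (hA : 8 * n + n < p) (hB : 3 * p ≤ 2 * (8 * n) + 13 * n) (hF : 8 * n + 11 * n < 2 * p)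
    (hcas : casoratian (bLin (8 * n + 2 * n) (8 * n) n) j ≠ 0) :
    (-11 : ℤ) ≤ padicValRat p (casoratian (bLin (8 * n + 2 * n) (8 * n) n) j) := by
  haveI : Fact p.Prime := ⟨hprime⟩
  have hp2 : p % 2 = 1 := Nat.odd_iff.1 (hprime.odd_of_ne_two (by omega))
  obtain ⟨hp5, hwin⟩ := window_fp (t := 8) (n := n) (p := p) (by omega) hn hA
  have hdeg : (p : ℤ) * 6 ≤ 2 * dOf (bLin (8 * n + 2 * n) (8 * n) n) + 1 := by
    rw [dOf_tf]; push_cast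
    have : (3 * p : ℤ) ≤ 2 * (8 * n) + 13 * n := by exact_mod_cast hB
    linarith
  exact origin_O8 (inPolytope_tf 8 n) (inPolytope_shift_tf_j (t := 8) (by omega) hn j hj1 hj7) hj1 hj7 hprime hp5 (le_b0_tf (by omega)) hwin
    (originClasses_s8 hn hA hB hF hp2) hdeg hcas

/-- **The `t = 9` sliver** `10n < p`, `3p ≤ 31n`, any `j`, all `n ≥ 1`: `v_p(Cas_j(bTop 9 n)) ≥ −11` (ORIGIN law at `M = 8`, both parities of `n`). -/
theorem cas_ge_s9 {n j p : ℕ} (hn : 1 ≤ n) (hj1 : 1 ≤ j) (hj7 : j ≤ 7) (hprime : p.Prime)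
    (hA : 9 * n + n < p) (hB : 3 * p ≤ 2 * (9 * n) + 13 * n)
    (hcas : casoratian (bLin (9 * n + 2 * n) (9 * n) n) j ≠ 0) :
    (-11 : ℤ) ≤ padicValRat p (casoratian (bLin (9 * n + 2 * n) (9 * n) n) j) := by
  haveI : Fact p.Prime := ⟨hprime⟩
  have hp2 : p % 2 = 1 := Nat.odd_iff.1 (hprime.odd_of_ne_two (by omega))
  obtain ⟨hp5, hwin⟩ := window_fp (t := 9) (n := n) (p := p) (by omega) hn hA
  have hdeg : (p : ℤ) * 6 ≤ 2 * dOf (bLin (9 * n + 2 * n) (9 * n) n) + 1 := by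
    rw [dOf_tf]; push_cast
    have : (3 * p : ℤ) ≤ 2 * (9 * n) + 13 * n := by exact_mod_cast hB
    linarith
  have hC : OriginWindowClasses (bLin (9 * n + 2 * n) (9 * n) n) p 8 Ray4Windows.D8 Ray4Windows.S8 T1Rays.Pc8 := by
    rcases Nat.mod_two_eq_zero_or_one n with hr | hr
    · exact originClasses_s9_ev hn hA hB hp2 hr
    · exact originClasses_s9_od hn hA hB hp2 hr
  exact origin_O8 (inPolytope_tf 9 n) (inPolytope_shift_tf_j (t := 9) (by omega) hn j hj1 hj7) hj1 hj7 hprime hp5 (le_b0_tf (by omega)) hwin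
    hC hdeg hcas

/-! ## §3 PATH accounting: the sliver, the whole first period for `t = 8, 9`, the node for every `t ≥ 4` -/

/-- **`PathAccountingFirstPeriod`'s conclusion on the sliver** `(t+1)n < p`, `3p ≤ (2t+13)n`, `(t+11)n < 2p` for `t ∈ {8, 9}`, every `j`, all `n ≥ 1`:
`⌊d/p⌋ = 3`, `N_p = 20`, `C⋆ ≤ 11`, so the node asks at most `−11`. -/
theorem pathAccounting_tf_sliver (t n j p : ℕ) (ht : t = 8 ∨ t = 9) (hn : 1 ≤ n) (hj1 : 1 ≤ j) (hj7 : j ≤ 7) (hprime : p.Prime)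
    (hA : t * n + n < p) (hB : 3 * p ≤ 2 * (t * n) + 13 * n) (hF : t * n + 11 * n < 2 * p)
    (hcas : casoratian (bLin (t * n + 2 * n) (t * n) n) j ≠ 0) :
    dOf (bLin (t * n + 2 * n) (t * n) n) / (p : ℤ) - pairFloors (bLin (t * n + 2 * n) (t * n) n) p
        - min (if 2 ≤ dOf (bLin (t * n + 2 * n) (t * n) n) / (p : ℤ) then (1 : ℤ) else 0) (5 - (cStar (bLin (t * n + 2 * n) (t * n) n) p : ℤ))
      ≤ padicValRat p (casoratian (bLin (t * n + 2 * n) (t * n) n) j) := by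
  have h11 : (-11 : ℤ) ≤ padicValRat p (casoratian (bLin (t * n + 2 * n) (t * n) n) j) := by
    rcases ht with rfl | rfl
    · exact cas_ge_s8 hn hj1 hj7 hprime hA hB hF hcas
    · exact cas_ge_s9 hn hj1 hj7 hprime hA hB hcas
  have htn : 8 * n ≤ t * n ∧ t * n ≤ 9 * n := by rcases ht with rfl | rfl <;> omega
  have hC11 : (cStar (bLin (t * n + 2 * n) (t * n) n) p : ℤ) ≤ 11 := by exact_mod_cast cStar_le_eleven _ p
  have hmin : -6 ≤ min (1 : ℤ) (5 - (cStar (bLin (t * n + 2 * n) (t * n) n) p : ℤ)) := le_min (by norm_num) (by linarith)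
  rw [dOf_tf_div_three (by omega) hB, N_c1 hA (by omega) hF, if_pos (by norm_num)]
  linarith

/-- **PATH accounting on the WHOLE FIRST PERIOD of `bTop 8 n` and `bTop 9 n`, every direction `j`, all `n ≥ 1`**: for every prime `p` with `(t+11)n < 2p`
and `Cas_j(bTop t n) ≠ 0` the node's inequality holds (for `t ≤ 9` the first period lies above the innermost block; above `d/3` by gen 16's
`pathAccounting_tf`, on the sliver by §2). -/
theorem pathAccounting_tf_firstPeriod_89 (t n j p : ℕ) (ht : t = 8 ∨ t = 9) (hn : 1 ≤ n) (hj1 : 1 ≤ j) (hj7 : j ≤ 7) (hprime : p.Prime)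
    (hF : t * n + 11 * n < 2 * p) (hcas : casoratian (bLin (t * n + 2 * n) (t * n) n) j ≠ 0) :
    dOf (bLin (t * n + 2 * n) (t * n) n) / (p : ℤ) - pairFloors (bLin (t * n + 2 * n) (t * n) n) p
        - min (if 2 ≤ dOf (bLin (t * n + 2 * n) (t * n) n) / (p : ℤ) then (1 : ℤ) else 0) (5 - (cStar (bLin (t * n + 2 * n) (t * n) n) p : ℤ))
      ≤ padicValRat p (casoratian (bLin (t * n + 2 * n) (t * n) n) j) := by
  have htn : 8 * n ≤ t * n ∧ t * n ≤ 9 * n := by rcases ht with rfl | rfl <;> omega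
  have hA : t * n + n < p := by omega
  by_cases hD : 2 * (t * n) + 13 * n < 3 * p
  · exact pathAccounting_tf t n j p (by omega) hn hj1 hj7 hprime hA hD hF hcas
  · exact pathAccounting_tf_sliver t n j p ht hn hj1 hj7 hprime hA (by omega) hF hcas

/-- **The node `PathAccountingFirstPeriod` restricted to `bTop 8 n` and `bTop 9 n`, literally** (all its binders, `b := bTop t n`), all `n ≥ 1`. -/
theorem pathAccountingFirstPeriod_on_tf89 (t : ℕ) (ht : t = 8 ∨ t = 9) (n p : ℕ) (hn : 1 ≤ n) :
    InPolytope (bTop t n) → Sorted7 (bTop t n) → InPolytope (shift (bTop t n) 7) → p.Prime → 5 ≤ p →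
    (bTop t n 0 + 2 : ℤ) < (p : ℤ) ^ 2 → FirstPeriod (bTop t n) p → casoratian (bTop t n) 7 ≠ 0 →
      dOf (bTop t n) / (p : ℤ) - pairFloors (bTop t n) p
          - min (if 2 ≤ dOf (bTop t n) / (p : ℤ) then (1 : ℤ) else 0) (5 - (cStar (bTop t n) p : ℤ))
        ≤ padicValRat p (casoratian (bTop t n) 7) :=
  fun _ _ _ hprime _ _ hfp hcas =>
    pathAccounting_tf_firstPeriod_89 t n 7 p ht hn (by norm_num) (by norm_num) hprime (fp_bound_of_firstPeriod hfp) hcas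

/-- **THE NODE ON THE WHOLE TOP FAMILY: `PathAccountingFirstPeriod` with `b := bTop t n`, binders VERBATIM, for EVERY `t ≥ 4` and EVERY `n ≥ 1`** —
Brown–Zudilin's prime-by-prime accounting (28)+(30), Casoratian form, on the whole first period of every direction `(7,13,9,12,11,15,17,12) + (t−6)·(1,…,1)`
(`4 ≤ t ≤ 7`: gen 16's `pathAccountingFirstPeriod_on_tf`; `t = 8, 9`: §3; `t ≥ 10`: gen 16's `pathAccountingFirstPeriod_on_tf_ge10`). -/
theorem pathAccountingFirstPeriod_on_bTop_all (t : ℕ) (ht : 4 ≤ t) (n p : ℕ) (hn : 1 ≤ n) :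
    InPolytope (bTop t n) → Sorted7 (bTop t n) → InPolytope (shift (bTop t n) 7) → p.Prime → 5 ≤ p →
    (bTop t n 0 + 2 : ℤ) < (p : ℤ) ^ 2 → FirstPeriod (bTop t n) p → casoratian (bTop t n) 7 ≠ 0 →
      dOf (bTop t n) / (p : ℤ) - pairFloors (bTop t n) p
          - min (if 2 ≤ dOf (bTop t n) / (p : ℤ) then (1 : ℤ) else 0) (5 - (cStar (bTop t n) p : ℤ))
        ≤ padicValRat p (casoratian (bTop t n) 7) := by
  by_cases h7 : t ≤ 7
  · exact pathAccountingFirstPeriod_on_tf t ht h7 n p hn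
  by_cases h9 : t ≤ 9
  · exact pathAccountingFirstPeriod_on_tf89 t (by omega) n p hn
  · exact pathAccountingFirstPeriod_on_tf_ge10 t (by omega) n p hn

/-- **PATH accounting on the whole first period of the TOP family, every direction `j`, EVERY `t ≥ 4`, all `n ≥ 1`** (any-`j` form of the above;
for `t ≤ 9` the first period lies above the innermost block, for `t ≥ 10` gen 16's `pathAccounting_tf_firstPeriod`). -/
theorem pathAccounting_tf_firstPeriod_all (t n j p : ℕ) (ht : 4 ≤ t) (hn : 1 ≤ n) (hj1 : 1 ≤ j) (hj7 : j ≤ 7) (hprime : p.Prime)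
    (hF : t * n + 11 * n < 2 * p) (hcas : casoratian (bLin (t * n + 2 * n) (t * n) n) j ≠ 0) :
    dOf (bLin (t * n + 2 * n) (t * n) n) / (p : ℤ) - pairFloors (bLin (t * n + 2 * n) (t * n) n) p
        - min (if 2 ≤ dOf (bLin (t * n + 2 * n) (t * n) n) / (p : ℤ) then (1 : ℤ) else 0) (5 - (cStar (bLin (t * n + 2 * n) (t * n) n) p : ℤ))
      ≤ padicValRat p (casoratian (bLin (t * n + 2 * n) (t * n) n) j) := by
  by_cases h7 : t ≤ 7
  · have htn : t * n ≤ 7 * n := Nat.mul_le_mul_right n h7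
    have htn' : 4 * n ≤ t * n := Nat.mul_le_mul_right n ht
    exact pathAccounting_tf t n j p ht hn hj1 hj7 hprime (by omega) (by omega) hF hcas
  by_cases h9 : t ≤ 9
  · exact pathAccounting_tf_firstPeriod_89 t n j p (by omega) hn hj1 hj7 hprime hF hcas
  · exact pathAccounting_tf_firstPeriod t n j p (by omega) hn hj1 hj7 hprime hF hcas

/-- **(CV) on the whole first period of the TOP family, every direction `j`, every `t ≥ 4`, all `n`** (the (CV) value never exceeds the PATH value). -/
theorem tfRayCV_firstPeriod_all (t n j p : ℕ) (ht : 4 ≤ t) (hn : 1 ≤ n) (hj1 : 1 ≤ j) (hj7 : j ≤ 7) (hprime : p.Prime)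
    (hF : t * n + 11 * n < 2 * p) (hcas : casoratian (bLin (t * n + 2 * n) (t * n) n) j ≠ 0) :
    refund (bLin (t * n + 2 * n) (t * n) n) p - pairFloors (bLin (t * n + 2 * n) (t * n) n) p
      ≤ padicValRat p (casoratian (bLin (t * n + 2 * n) (t * n) n) j) := by
  linarith [refund_le_pathHead (bLin (t * n + 2 * n) (t * n) n) p (5 - (cStar (bLin (t * n + 2 * n) (t * n) n) p : ℤ)),
    pathAccounting_tf_firstPeriod_all t n j p ht hn hj1 hj7 hprime hF hcas]

end Summit.KontsevichZagierPeriods.Zeta5Search.TopFamFP
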